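import Mathlib
import HarnessLib
import Summits.HubbardSuperconductivity.HubbardSuperconductivity.Theorems.KLProgrammeKLRegimeTwoVolumeReadoutPinCopies

/-!
# Route `KLProgramme` — ENGINE child `KLRegimeEngineV16` (stmt-HubbardSuperconductivity-20236), `stub_twoLeg_scale0`, conjunct
# (E3f-AT)₀, spatial nested leg `hsp`: the two-volume local part from k3c4-p1's BLOCK-DEFECT STEP BOUND — the composed door
# (cell gate-hubbard-kl, seat hubbard-kl-k3c5-p2 g6, β′ lane)

`…TwoVolumeReadoutPin.abs_klLocalPart_sub_le_gridDefect_pin` ⊕ `…TwoVolumeReadoutPinCopies.gridDefect_pin_eq_copies_defect` ⊕ the shape of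
k3c4-p1's model step [tree] `…TwoVolumeGridBlockStep.hubbardGrid_sum_norm_kernel_sub_le` (pinned two-leg difference between the fine grid
action and the block-read coarse one, `Σ_{X : X 0 = w} ‖kernel W′ 2 X − [all legs in w's block]·kernel W 2 (red ∘ X)‖ ≤ B`):

* `copies_kernel_two_eq_ite` — the copies kernel `kernel (Σ_β W∘F β) 2 X` IS the block-read kernel `[∀ i j, blk]·kernel W 2 (red∘X)` (by
  [tree] `kernel_copies_sum` with the `e` of `exists_gridLegBlockEquiv`);
* `gridDefect_pin_le_of_copiesStep` — at a pin of residue `(r₀,r₀)`, `Def_w ≤ B` whenever the `(w⁺, ·)` pinned block-step sum is `≤ B`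
  (the `(↑,−)` second legs are a sub-family);
* **`abs_klLocalPart_sub_le_of_copiesStep`** — for `0 < β`, `Lf = b·Lc`, `2M ≤ N`, `4M ≤ N + 1`, unit framed partition functions, every scale
  `n`, a pin `w` of residue `(r₀,r₀)` and ANY bound `B` of the pinned block-step sum of the RESUMMED quartic grid actions at `w`:
  `|klLocalPart Lc … n θ − klLocalPart Lf … n θ| ≤ 2·far|c_{Re E∘p_f}| + ‖τ̌_c‖₁·(2N/|β|)·B + 2(2N/|β|)(M₁(τ̌_f)N₂(w) + ‖τ̌_f‖₁M₂(w))/((Lc−1)/2+1)`.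
  With `B` := the right-hand side of `hubbardGrid_sum_norm_kernel_sub_le` (ν = 0, symbol `F i σ q = u_i(q)/(1+u_i(q)K(q))`, `n = 1`, `p = 0`)
  this is the (E3f-AT)₀ spatial leg up to the rate bookkeeping.

Proofs only; no definitions.
-/

noncomputable section

namespace Summit.HubbardSuperconductivity.HubbardSuperconductivity.Theorems.TwoVolumeDefect

set_option linter.dupNamespace false -- summit = problem name (single-conjunct summit), D-0017

open Finset Complex Literature.MathematicalPhysics.QuantumLattice Literature.Probability.LatticeModels GrassmannAlgebra
open Summit.HubbardSuperconductivity.HubbardSuperconductivity.Theorems.KLRegimeSplit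
open Summit.HubbardSuperconductivity.HubbardSuperconductivity.Theorems.KLProgrammeLegKernels
open Summit.HubbardSuperconductivity.HubbardSuperconductivity.Theorems.TwoPointAssembly
open scoped ComplexConjugate

section Step

variable {b Lc Lf N : ℕ} [NeZero Lc] [NeZero Lf]

omit [NeZero Lf] in
/-- **The copies kernel is the block-read kernel**: for the block structure `e` (`blk = ⌊x/m⌋`, `red = x mod m`) and embeddings `F β`,
`kernel (Σ_β W∘F β) 2 X′ = [∀ i j, blk (X′ i) j = blk (X′ 0) j]·kernel W 2 (red ∘ X′)`. -/
theorem copies_kernel_two_eq_ite (e : GridLeg (GridPoint Lf N) ≃ (Fin 2 → Fin b) × GridLeg (GridPoint Lc N))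
    (he1 : ∀ X' i, ((e X').1 i : ℕ) = (X'.1.1.2 i).val / Lc)
    (he2 : ∀ X', (e X').2 = (((X'.1.1.1, fun i => (((X'.1.1.2 i).val : ℕ) : ZMod Lc)), X'.1.2), X'.2))
    (F : (Fin 2 → Fin b) → (GridLeg (GridPoint Lc N) → ℂ) →ₗ[ℂ] (GridLeg (GridPoint Lf N) → ℂ))
    (hF : ∀ β v X', F β v X' = if (e X').1 = β then v (e X').2 else 0)
    (W : GrassmannAlgebra ℂ (GridLeg (GridPoint Lc N))) (X' : Fin 2 → GridLeg (GridPoint Lf N)) :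
    kernel ℂ (∑ β, ExteriorAlgebra.map (F β) W) 2 X' =
      if ∀ i j, ((X' i).1.1.2 j).val / Lc = ((X' 0).1.1.2 j).val / Lc then
        kernel ℂ W 2 (fun i => ((((X' i).1.1.1, fun j => ((((X' i).1.1.2 j).val : ℕ) : ZMod Lc)), (X' i).1.2), (X' i).2))
      else 0 := by
  classical
  rw [kernel_copies_sum e F hF W (0 : Fin 2)]
  have hiff : (∀ i, (e (X' i)).1 = (e (X' 0)).1) ↔ ∀ i j, ((X' i).1.1.2 j).val / Lc = ((X' 0).1.1.2 j).val / Lc := by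
    constructor
    · intro h i j
      rw [← he1, ← he1, h i]
    · intro h i
      funext j
      exact Fin.ext (by rw [he1, he1, h i j])
  simp only [hiff]
  split_ifs with h
  · congr 1
    funext i
    rw [he2]
  · rfl

/-- **`Def_w ≤ B` from the pinned block-step sum.**  At a pin `w` of residue `(r₀,r₀)`, if
`Σ_{X : X 0 = (w,σ,+)} ‖kernel W′ 2 X − [blocks]·kernel W 2 (red∘X)‖ ≤ B` then the read-out's `Def_w ≤ B`. -/
theorem gridDefect_pin_le_of_copiesStep (hL : Lf = b * Lc) {w : GridPoint Lf N} (hw : ∀ i, (w.2 i).val % Lc = (Lc - 1) / 2)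
    (W : GrassmannAlgebra ℂ (GridLeg (GridPoint Lc N))) (W' : GrassmannAlgebra ℂ (GridLeg (GridPoint Lf N))) (σ : Fin 2) {B : ℝ}
    (hstep : ∑ X ∈ univ.filter (fun X : Fin 2 → GridLeg (GridPoint Lf N) => X 0 = ((w, σ), 0)),
      ‖kernel ℂ W' 2 X - (if ∀ i j, ((X i).1.1.2 j).val / Lc = ((X 0).1.1.2 j).val / Lc then
        kernel ℂ W 2 (fun i => ((((X i).1.1.1, fun j => ((((X i).1.1.2 j).val : ℕ) : ZMod Lc)), (X i).1.2), (X i).2)) else 0)‖ ≤ B) :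
    (∑ p₁ : GridPoint Lc N, ‖kernel ℂ W 2 (fun i => ((![((w.1, fun _ : Fin 2 => (((Lc - 1) / 2 : ℕ) : ZMod Lc)) : GridPoint Lc N), p₁] i, σ), i)) -
        kernel ℂ W' 2 (fun i => ((![w, ((p₁.1, w.2 + Torus.proj Lf (Torus.cRep (p₁.2 - fun _ : Fin 2 => (((Lc - 1) / 2 : ℕ) : ZMod Lc)))) :
          GridPoint Lf N)] i, σ), i))‖) +
      ∑ p₁' ∈ univ.filter (fun p₁' : GridPoint Lf N => p₁' ∉ Set.range (fun p : GridPoint Lc N =>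
          ((p.1, w.2 + Torus.proj Lf (Torus.cRep (p.2 - fun _ : Fin 2 => (((Lc - 1) / 2 : ℕ) : ZMod Lc)))) : GridPoint Lf N))),
        ‖kernel ℂ W' 2 (fun i => ((![w, p₁'] i, σ), i))‖ ≤ B := by
  classical
  obtain ⟨e, he1, he2⟩ := exists_gridLegBlockEquiv hL N
  set Fe : (Fin 2 → Fin b) → (GridLeg (GridPoint Lc N) → ℂ) →ₗ[ℂ] (GridLeg (GridPoint Lf N) → ℂ) := fun β' =>
    LinearMap.pi (fun X' : GridLeg (GridPoint Lf N) => if (e X').1 = β' then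
      (LinearMap.proj (e X').2 : (GridLeg (GridPoint Lc N) → ℂ) →ₗ[ℂ] ℂ) else 0) with hFe_def
  have hFe : ∀ β' v X', Fe β' v X' = if (e X').1 = β' then v (e X').2 else 0 := fun β' v X' => blockEmb_pi_apply ℂ e β' v X'
  rw [gridDefect_pin_eq_copies_defect hL e he1 he2 Fe hFe hw W W' σ]
  simp only [copies_kernel_two_eq_ite e he1 he2 Fe hFe]
  -- the `(σ,−)` second legs form a sub-family of all second legs
  set str : GridPoint Lf N → (Fin 2 → GridLeg (GridPoint Lf N)) := fun p₁' i => ((![w, p₁'] i, σ), i) with hstr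
  have hinj : Function.Injective str := by
    intro p q h
    have := congrFun h 1
    simpa [hstr] using this
  have hsub : Finset.univ.image str ⊆ univ.filter (fun X : Fin 2 → GridLeg (GridPoint Lf N) => X 0 = ((w, σ), 0)) := by
    intro X hX
    obtain ⟨p, _, rfl⟩ := Finset.mem_image.1 hX
    simp [hstr]
  calc ∑ p₁' : GridPoint Lf N, ‖kernel ℂ W' 2 (str p₁') - (if ∀ i j, ((str p₁' i).1.1.2 j).val / Lc = ((str p₁' 0).1.1.2 j).val / Lc then
          kernel ℂ W 2 (fun i => ((((str p₁' i).1.1.1, fun j => ((((str p₁' i).1.1.2 j).val : ℕ) : ZMod Lc)), (str p₁' i).1.2), (str p₁' i).2))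
          else 0)‖
      = ∑ X ∈ Finset.univ.image str, ‖kernel ℂ W' 2 X - (if ∀ i j, ((X i).1.1.2 j).val / Lc = ((X 0).1.1.2 j).val / Lc then
          kernel ℂ W 2 (fun i => ((((X i).1.1.1, fun j => ((((X i).1.1.2 j).val : ℕ) : ZMod Lc)), (X i).1.2), (X i).2)) else 0)‖ := by
        rw [Finset.sum_image (fun p _ q _ h => hinj h)]
    _ ≤ _ := (Finset.sum_le_sum_of_subset_of_nonneg hsub fun _ _ _ => norm_nonneg _).trans hstep

end Step

section Door

variable {b Lc Lf M N : ℕ} [NeZero Lc] [NeZero Lf] [NeZero M] [NeZero N]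

/-- **THE COMPOSED DOOR.**  See the module docstring: the Grassmann input is ONE number `B` bounding the pinned block-step sum of the resummed
quartic grid actions at a pin of residue `(r₀,r₀)` — the conclusion of k3c4-p1's `hubbardGrid_sum_norm_kernel_sub_le` at `n = 1`, `p = 0`. -/
theorem abs_klLocalPart_sub_le_of_copiesStep (hL : Lf = b * Lc) {β : ℝ} (hβ : 0 < β) (hN : 2 * M ≤ N) (hN4 : 4 * M ≤ N + 1)
    (U μ : ℝ) (K : TrigPolyC4v) (n : ℕ) (w : GridPoint Lf N)
    (hZc : IsUnit (effPartitionFn ℂ (normalCovariance Lc M (uvSymbolCT Lc M β μ K (klScale klE0 n)))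
      (hubbardInteraction Lc M β U + counterQuadratic Lc M β K)))
    (hZf : IsUnit (effPartitionFn ℂ (normalCovariance Lf M (uvSymbolCT Lf M β μ K (klScale klE0 n)))
      (hubbardInteraction Lf M β U + counterQuadratic Lf M β K)))
    (hwres : ∀ i, (w.2 i).val % Lc = (Lc - 1) / 2) {B : ℝ}
    (hstep : ∑ X ∈ univ.filter (fun X : Fin 2 → GridLeg (GridPoint Lf N) => X 0 = ((w, 0), 0)),
      ‖kernel ℂ (effAction ℂ ((hubbardGridSub Lf M β N).transpose *
              normalCovariance Lf M (fun ks => uvSymbolCT Lf M β μ K (klScale klE0 n) ks /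
                (1 + uvSymbolCT Lf M β μ K (klScale klE0 n) ks * ((K.eval (latticeMomentum Lf ks.1.2) / (β * (Lf : ℝ) ^ 2) : ℝ) : ℂ))) *
              hubbardGridSub Lf M β N) (hubbardGridInteraction Lf N β U)) 2 X -
        (if ∀ i j, ((X i).1.1.2 j).val / Lc = ((X 0).1.1.2 j).val / Lc then
          kernel ℂ (effAction ℂ ((hubbardGridSub Lc M β N).transpose *
              normalCovariance Lc M (fun ks => uvSymbolCT Lc M β μ K (klScale klE0 n) ks /
                (1 + uvSymbolCT Lc M β μ K (klScale klE0 n) ks * ((K.eval (latticeMomentum Lc ks.1.2) / (β * (Lc : ℝ) ^ 2) : ℝ) : ℂ))) *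
              hubbardGridSub Lc M β N) (hubbardGridInteraction Lc N β U)) 2
            (fun i => ((((X i).1.1.1, fun j => ((((X i).1.1.2 j).val : ℕ) : ZMod Lc)), (X i).1.2), (X i).2)) else 0)‖ ≤ B)
    (θ : ℝ) :
    |klLocalPart Lc M β U μ K n θ - klLocalPart Lf M β U μ K n θ| ≤
      2 * (∑ y ∈ univ.filter (fun y : TorusSite 2 Lf => Torus.proj Lf (Torus.cRep (fun i => (((y i).val : ℕ) : ZMod Lc))) ≠ y),
        |torusCosCoeff Lf (fun k => ((K.eval (latticeMomentum Lf k) : ℂ) -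
          (K.eval (latticeMomentum Lf k) : ℂ) ^ 2 *
            (uvSymbolFn 1 (klScale klE0 n) (-2 * (∑ l : Fin 2, Real.cos (latticeMomentum Lf k l)) - μ - K.eval (latticeMomentum Lf k))
                (matsubaraFreq β M (omega0 M)) /
              (1 + uvSymbolFn 1 (klScale klE0 n) (-2 * (∑ l : Fin 2, Real.cos (latticeMomentum Lf k l)) - μ - K.eval (latticeMomentum Lf k))
                (matsubaraFreq β M (omega0 M)) * K.eval (latticeMomentum Lf k)))).re) y|) +
      ((∑ z : TorusSite 2 Lc, ‖torusFourierInv (fun k => (1 - (K.eval (latticeMomentum Lc k) : ℂ) *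
          (uvSymbolFn 1 (klScale klE0 n) (-2 * (∑ l : Fin 2, Real.cos (latticeMomentum Lc k l)) - μ - K.eval (latticeMomentum Lc k))
              (matsubaraFreq β M (omega0 M)) /
            (1 + uvSymbolFn 1 (klScale klE0 n) (-2 * (∑ l : Fin 2, Real.cos (latticeMomentum Lc k l)) - μ - K.eval (latticeMomentum Lc k))
              (matsubaraFreq β M (omega0 M)) * K.eval (latticeMomentum Lc k)))) ^ 2) z‖) * (2 * N / |β| * B) +
      2 * (((∑ z : TorusSite 2 Lf, (Torus.tnorm z : ℝ) * ‖torusFourierInv (fun k => (1 - (K.eval (latticeMomentum Lf k) : ℂ) *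
              (uvSymbolFn 1 (klScale klE0 n) (-2 * (∑ l : Fin 2, Real.cos (latticeMomentum Lf k l)) - μ - K.eval (latticeMomentum Lf k))
                  (matsubaraFreq β M (omega0 M)) /
                (1 + uvSymbolFn 1 (klScale klE0 n) (-2 * (∑ l : Fin 2, Real.cos (latticeMomentum Lf k l)) - μ - K.eval (latticeMomentum Lf k))
                  (matsubaraFreq β M (omega0 M)) * K.eval (latticeMomentum Lf k)))) ^ 2) z‖) *
            (2 * N / |β| * ∑ p₁' : GridPoint Lf N, ‖kernel ℂ (effAction ℂ ((hubbardGridSub Lf M β N).transpose *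
              normalCovariance Lf M (fun ks => uvSymbolCT Lf M β μ K (klScale klE0 n) ks /
                (1 + uvSymbolCT Lf M β μ K (klScale klE0 n) ks * ((K.eval (latticeMomentum Lf ks.1.2) / (β * (Lf : ℝ) ^ 2) : ℝ) : ℂ))) *
              hubbardGridSub Lf M β N) (hubbardGridInteraction Lf N β U)) 2 (fun i => ((![w, p₁'] i, 0), i))‖) +
          (∑ z : TorusSite 2 Lf, ‖torusFourierInv (fun k => (1 - (K.eval (latticeMomentum Lf k) : ℂ) *
              (uvSymbolFn 1 (klScale klE0 n) (-2 * (∑ l : Fin 2, Real.cos (latticeMomentum Lf k l)) - μ - K.eval (latticeMomentum Lf k))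
                  (matsubaraFreq β M (omega0 M)) /
                (1 + uvSymbolFn 1 (klScale klE0 n) (-2 * (∑ l : Fin 2, Real.cos (latticeMomentum Lf k l)) - μ - K.eval (latticeMomentum Lf k))
                  (matsubaraFreq β M (omega0 M)) * K.eval (latticeMomentum Lf k)))) ^ 2) z‖) *
            (2 * N / |β| * ∑ p₁' : GridPoint Lf N, (Torus.tnorm (p₁'.2 - w.2) : ℝ) *
              ‖kernel ℂ (effAction ℂ ((hubbardGridSub Lf M β N).transpose *
                normalCovariance Lf M (fun ks => uvSymbolCT Lf M β μ K (klScale klE0 n) ks /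
                  (1 + uvSymbolCT Lf M β μ K (klScale klE0 n) ks * ((K.eval (latticeMomentum Lf ks.1.2) / (β * (Lf : ℝ) ^ 2) : ℝ) : ℂ))) *
                hubbardGridSub Lf M β N) (hubbardGridInteraction Lf N β U)) 2 (fun i => ((![w, p₁'] i, 0), i))‖)) /
        (((Lc - 1) / 2 + 1 : ℕ) : ℝ)))  := by
  have hdoor := abs_klLocalPart_sub_le_gridDefect_pin hL hβ hN hN4 U μ K n w hZc hZf θ
  have hdef := gridDefect_pin_le_of_copiesStep (N := N) hL hwres
    (effAction ℂ ((hubbardGridSub Lc M β N).transpose *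
              normalCovariance Lc M (fun ks => uvSymbolCT Lc M β μ K (klScale klE0 n) ks /
                (1 + uvSymbolCT Lc M β μ K (klScale klE0 n) ks * ((K.eval (latticeMomentum Lc ks.1.2) / (β * (Lc : ℝ) ^ 2) : ℝ) : ℂ))) *
              hubbardGridSub Lc M β N) (hubbardGridInteraction Lc N β U))
    (effAction ℂ ((hubbardGridSub Lf M β N).transpose *
              normalCovariance Lf M (fun ks => uvSymbolCT Lf M β μ K (klScale klE0 n) ks /
                (1 + uvSymbolCT Lf M β μ K (klScale klE0 n) ks * ((K.eval (latticeMomentum Lf ks.1.2) / (β * (Lf : ℝ) ^ 2) : ℝ) : ℂ))) *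
              hubbardGridSub Lf M β N) (hubbardGridInteraction Lf N β U)) 0 hstep
  have hβ0 : 0 < |β| := abs_pos.2 hβ.ne'
  have hτ0 : 0 ≤ ∑ z : TorusSite 2 Lc, ‖torusFourierInv (fun k => (1 - (K.eval (latticeMomentum Lc k) : ℂ) *
      (uvSymbolFn 1 (klScale klE0 n) (-2 * (∑ l : Fin 2, Real.cos (latticeMomentum Lc k l)) - μ - K.eval (latticeMomentum Lc k))
          (matsubaraFreq β M (omega0 M)) /
        (1 + uvSymbolFn 1 (klScale klE0 n) (-2 * (∑ l : Fin 2, Real.cos (latticeMomentum Lc k l)) - μ - K.eval (latticeMomentum Lc k))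
          (matsubaraFreq β M (omega0 M)) * K.eval (latticeMomentum Lc k)))) ^ 2) z‖ := Finset.sum_nonneg fun _ _ => norm_nonneg _
  have hmid := mul_le_mul_of_nonneg_left (mul_le_mul_of_nonneg_left hdef (by positivity : (0 : ℝ) ≤ 2 * N / |β|)) hτ0
  linarith

end Door

end Summit.HubbardSuperconductivity.HubbardSuperconductivity.Theorems.TwoVolumeDefect

end
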